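import Summits.PneNP.PneNP.Theorems.ConvexRankGatesCaptureDualSpan
import Literature.Computability.Complexity.ExtMonotoneCircuits
import HarnessLib

/-!
# Crux `Capture` (stmt-PneNP-2659) — duality audit, cell D2′: the DUAL of the full-rank (span-all) gate
# over `𝔽₂` is a polynomial extended circuit (an OR of dual-span PERM gates)

The primal door `v ↦ [the selected vectors a i (v i = 1) span 𝔽₂^k]` is an AND of `k` span programs (one
per basis vector), hence abelian-PERM / GRANK material. Its Boolean dual is the CO-RANK function

  `v ↦ [the UNselected vectors a i (v i = 0) do NOT span 𝔽₂^k]`,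

the finite-field, full-rank-threshold instance of the "one linear matroid" cell of the duality audit
(`Cruxes/Capture/DUALITY-AUDIT-c7.md`). Since the unit vectors span `𝔽₂^k`, the unselected rows fail to
span iff SOME unit vector `e_j` lies outside their span — an OR over `j < k` of dual-span gates, each of
which is ONE PERM gate on `≤ 2 (N + 1)` points by `dualSpan_onePermGate`. Hence a circuit with `k + 1`
gates over `B_{2(N+1)}` (`k` PERM gates and one `∨_k`) computes the co-rank door
(`dualFullRank_circuit`): this cell of the audit PASSES in the kernel. [folklore]
-/

namespace Summit.PneNP.PneNP.Theorems.Capture.DualityAudit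

set_option linter.dupNamespace false -- `Summit.PneNP.PneNP.…`: summit = sub-problem (D-0017)

open Literature.Computability.Complexity

/-- The unselected rows fail to span `𝔽₂^k` iff some unit vector lies outside their span. [folklore] -/
theorem span_ne_top_iff_exists_single {k : ℕ} (S : Set (Fin k → ZMod 2)) :
    Submodule.span (ZMod 2) S ≠ ⊤ ↔ ∃ j : Fin k, (Pi.single j 1 : Fin k → ZMod 2) ∉ Submodule.span (ZMod 2) S := by
  constructor
  · intro h
    by_contra hall
    simp only [not_exists, not_not] at hall
    apply h
    rw [eq_top_iff, ← (Pi.basisFun (ZMod 2) (Fin k)).span_eq, Submodule.span_le]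
    rintro _ ⟨j, rfl⟩
    rw [Pi.basisFun_apply]
    exact hall j
  · rintro ⟨j, hj⟩ h
    rw [h] at hj
    exact hj Submodule.mem_top

/-- **Duality-audit cell D2′ (registered sub-goal `dualFullRank_circuit`)**: the co-rank door
`[the unselected rows a i (v i = 0) do not span 𝔽₂^k]` — the Boolean dual of the full-rank span/GRANK door —
is computed by a circuit with `k + 1` gates over `B_{2(N+1)}`: `k` dual-span PERM gates
(`dualSpan_onePermGate`) and one `∨_k`. [folklore] -/
theorem dualFullRank_circuit : ∀ (k N : ℕ) (a : Fin N → Fin k → ZMod 2),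
    ∃ C : Circuit (Fin N), C.IsOver (extGate (2 * (N + 1))) ∧ C.size ≤ k + 1 ∧
      C.Computes fun v => decide (Submodule.span (ZMod 2) (a '' {i | v i = false}) ≠ ⊤) := by
  intro k N a
  classical
  -- the `k` dual-span gates, one per unit vector
  let g : Fin k → (Fin N → Bool) → Bool := fun j v =>
    decide ((Pi.single j 1 : Fin k → ZMod 2) ∉ Submodule.span (ZMod 2) (a '' {i | v i = false}))
  have hg : ∀ j, IsPermGate (2 * (N + 1)) ⟨N, g j⟩ := fun j =>
    dualSpan_onePermGate (Fin k → ZMod 2) N a (Pi.single j 1) (g j) fun v => by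
      simp only [g, decide_eq_true_eq]
  have hlayer : CktSize (extGate (2 * (N + 1))) (fun (v : Fin N → Bool) (j : Fin k) => g j v)
      (Fintype.card (Fin k) * 1) :=
    CktSize.pi_const fun j => by
      simpa using CktSize.gate (B := extGate (2 * (N + 1))) ⟨N, g j⟩ (hg j).mem_extGate _root_.id
  have hor : CktSize (extGate (2 * (N + 1))) (fun (u : Fin k → Bool) (_ : Unit) =>
      (GateFn.or k).2 fun j => u j) 1 :=
    CktSize.gate (B := extGate (2 * (N + 1))) (GateFn.or k) (ExtMonotoneGate.or k (by omega)) _root_.id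
  have hall := hlayer.comp hor
  rw [Fintype.card_fin, Nat.mul_one] at hall
  obtain ⟨C, hC, hs, he⟩ := hall.toCircuit
  refine ⟨C, hC, hs, fun v => ?_⟩
  rw [he v]
  show (GateFn.or k).2 (fun j => g j v) = _
  simp only [GateFn.or, g, decide_eq_true_eq]
  apply Bool.decide_congr
  rw [span_ne_top_iff_exists_single]

end Summit.PneNP.PneNP.Theorems.Capture.DualityAudit
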